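import Summits.QuantumFields.GaugeBoot.PolynomialObservables
import Summits.QuantumFields.GaugeBoot.ZdSchwingerDysonDLR
import Mathlib.Analysis.Calculus.MeanValue
import Mathlib.Analysis.SpecialFunctions.Exponential
import HarnessLib

/-!
# Polynomial Schwinger–Dyson states, I: the identity passes from polynomials to polynomials times `e^{βS}` (gauge-boot, L1 supplement)

HONEST FRAMING (cell `pub-gaugeboot`, page 1 of every file): the venture produces certified bounds
on lattice expectations at stated coupling, gauge group, dimension and torus size; NOT a mass gap,
NOT a continuum limit, NOT a string tension; NOT Yang–Mills-summit-bearing (barriers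
`FixedCouplingUltralocality`, `PerturbativeInvisibility`). Structural; it certifies no number.

## Content

`SchwingerDysonDeterminesWilson.lean` needs the Schwinger–Dyson identities for ALL observables
differentiable along the one-link shifts; a bootstrap only writes them for POLYNOMIALS in the link
matrix entries (Wilson loops, open strings). `IsPolySchwingerDysonState r k S β μ` asks the
identities `∫ f' dμ = β ∫ f S_i' dμ` only for `f ∈ polyFunctions r` (`PolynomialObservables.lean`).
This file: the actions are polynomial (`wilsonAction_mem_polyFunctions`,
`wilsonBoundaryAction_mem_polyFunctions`); the exponential partial sums and their derivatives
(`hasDerivAt_expPartialSum`, bounds, convergence); ★ `integral_deriv_mul_exp_eq_zero` — STEP 1: if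
the identity holds for polynomial `f` and `S` is polynomial, then `∫ h' e^{βS} dμ = 0` for every
polynomial `h` (feed `f_m = h Σ_{n<m} (βS)ⁿ/n!`, dominated convergence); and
`hasDerivAt_integral_comp_flow_mul` (differentiation under the integral along a flow). The sequel
`PolynomialSchwingerDyson.lean` finishes: polynomial SD state ⇒ SD state ⇒ Wilson / DLR.

References: S. Chatterjee, arXiv:1502.07719 §3; V. Kazakov, Z. Zheng, arXiv:2203.11360. Folklore.
-/

noncomputable section

open MeasureTheory Filter Topology NormedSpace
open scoped Matrix.Norms.Frobenius Nat
open Literature.MathematicalPhysics.QuantumFieldTheory (LatticeRep haarProbability)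

namespace Summit.QuantumFields.GaugeBoot

/-! ## The Wilson actions are polynomial observables -/

section Actions

open Literature.MathematicalPhysics.QuantumFieldTheory (Edge GaugeConfig wilsonAction plaquetteHolonomy)
open Literature.MathematicalPhysics.QuantumLattice
open Literature.Probability.LatticeModels (Site)

variable {d L : ℕ} {G : Type*} [Group G] [TopologicalSpace G] (r : LatticeRep G)

/-- ★ **The torus Wilson action is a polynomial observable.** [folklore] -/
theorem wilsonAction_mem_polyFunctions [NeZero L] :
    wilsonAction (d := d) (L := L) r.ρ ∈ polyFunctions (ι := Edge d L) r := by
  have h : wilsonAction (d := d) (L := L) r.ρ = ∑ p : Literature.MathematicalPhysics.QuantumFieldTheory.Plaquette d L,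
      fun U => ((r.N : ℝ) - (r.ρ (plaquetteHolonomy U p.1 p.2.1.1 p.2.1.2)).trace.re) := by
    funext U
    simp only [wilsonAction, Finset.sum_apply]
  rw [h]
  exact Subalgebra.sum_mem _ fun p _ =>
    const_sub_reTrace_word₄_mem_polyFunctions r (p.1, p.2.1.1) (p.1.shift p.2.1.1, p.2.1.2)
      (p.1.shift p.2.1.2, p.2.1.1) (p.1, p.2.1.2) _

/-- ★ **The `ℤ^d` boundary Wilson actions `S_Λ` are polynomial observables.** [folklore] -/
theorem wilsonBoundaryAction_mem_polyFunctions (Λ : Finset (ZdEdge d)) :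
    wilsonBoundaryAction r.ρ Λ ∈ polyFunctions (ι := ZdEdge d) r := by
  have h : wilsonBoundaryAction (G := G) r.ρ Λ = ∑ p ∈ plaquettesTouching Λ,
      fun U => ((r.N : ℝ) - plaquetteObs r.ρ p.1 p.2.1.1 p.2.1.2 U) := by
    funext U
    simp only [wilsonBoundaryAction, Finset.sum_apply]
  rw [h]
  exact Subalgebra.sum_mem _ fun p _ => by
    simpa only [plaquetteObs, plaquetteHolonomyZd] using
      const_sub_reTrace_word₄_mem_polyFunctions (ι := ZdEdge d) r (p.1, p.2.1.1)
        (p.1 + Pi.single p.2.1.1 1, p.2.1.2) (p.1 + Pi.single p.2.1.2 1, p.2.1.1) (p.1, p.2.1.2) (r.N : ℝ)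

end Actions

/-! ## Partial sums of the exponential series -/

section ExpSeries

open Finset

/-- `d/dx Σ_{n<m} xⁿ/n! = Σ_{n<m} n xⁿ⁻¹/n!`. [folklore] -/
theorem hasDerivAt_expPartialSum (m : ℕ) (x : ℝ) :
    HasDerivAt (fun y : ℝ => ∑ n ∈ range m, y ^ n / n !) (∑ n ∈ range m, (n : ℝ) * x ^ (n - 1) / n !) x :=
  HasDerivAt.fun_sum fun n _ => (hasDerivAt_pow n x).div_const _

/-- The derivative partial sum is the previous partial sum. [folklore] -/
theorem derivPartialSum_succ (m : ℕ) (x : ℝ) :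
    ∑ n ∈ range (m + 1), (n : ℝ) * x ^ (n - 1) / n ! = ∑ n ∈ range m, x ^ n / n ! := by
  rw [Finset.sum_range_succ']
  simp only [Nat.cast_zero, zero_mul, zero_div, add_zero, Nat.add_sub_cancel, Nat.cast_succ,
    Nat.factorial_succ, Nat.cast_mul]
  refine Finset.sum_congr rfl fun n _ => ?_
  have hn : (n : ℝ) + 1 ≠ 0 := by positivity
  rw [mul_div_mul_left _ _ hn]

/-- `|Σ_{n<m} xⁿ/n!| ≤ e^{|x|}`. [folklore] -/
theorem abs_expPartialSum_le (m : ℕ) (x : ℝ) : |∑ n ∈ range m, x ^ n / n !| ≤ Real.exp |x| := by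
  calc |∑ n ∈ range m, x ^ n / n !| ≤ ∑ n ∈ range m, |x ^ n / n !| := Finset.abs_sum_le_sum_abs _ _
    _ = ∑ n ∈ range m, |x| ^ n / n ! := by simp [abs_div, abs_pow]
    _ ≤ Real.exp |x| := Real.sum_le_exp_of_nonneg (abs_nonneg x) m

/-- `|Σ_{n<m} n xⁿ⁻¹/n!| ≤ e^{|x|}`. [folklore] -/
theorem abs_derivPartialSum_le (m : ℕ) (x : ℝ) :
    |∑ n ∈ range m, (n : ℝ) * x ^ (n - 1) / n !| ≤ Real.exp |x| := by
  cases m with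
  | zero => simpa using (Real.exp_pos |x|).le
  | succ m => rw [derivPartialSum_succ]; exact abs_expPartialSum_le m x

/-- The partial sums converge to the exponential. [folklore] -/
theorem tendsto_expPartialSum (x : ℝ) :
    Tendsto (fun m => ∑ n ∈ range m, x ^ n / n !) atTop (𝓝 (Real.exp x)) := by
  have h := (NormedSpace.expSeries_div_hasSum_exp x).tendsto_sum_nat
  rwa [← congrFun Real.exp_eq_exp_ℝ x] at h

/-- The derivative partial sums converge to the exponential. [folklore] -/
theorem tendsto_derivPartialSum (x : ℝ) :
    Tendsto (fun m => ∑ n ∈ range m, (n : ℝ) * x ^ (n - 1) / n !) atTop (𝓝 (Real.exp x)) := by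
  rw [← Filter.tendsto_add_atTop_iff_nat 1]
  simp only [derivPartialSum_succ]
  exact tendsto_expPartialSum x

end ExpSeries

/-! ## Polynomial Schwinger–Dyson states -/

section Poly

variable {ι : Type*} [DecidableEq ι] {G : Type*} [Group G] [TopologicalSpace G] [IsTopologicalGroup G]
  [CompactSpace G] [MeasurableSpace G] [BorelSpace G] [SecondCountableTopology G] [Countable ι]
  (r : LatticeRep G) {K : Type*}

/-- **Polynomial Schwinger–Dyson state**: as `IsSchwingerDysonState`, but the identities
`∫ f' dμ = β ∫ f S_i' dμ` are only asked for POLYNOMIAL observables `f ∈ polyFunctions r` (the test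
functions a bootstrap actually uses). [shape] A parametric definition of a proposition — NOT a fact.
[folklore] -/
def IsPolySchwingerDysonState (k : K → ℝ → G) (S : ι → (ι → G) → ℝ) (β : ℝ) (μ : Measure (ι → G)) :
    Prop :=
  ∀ (i : ι) (a : K), ∃ S' : (ι → G) → ℝ, Continuous S' ∧
    (∀ U, HasDerivAt (fun t => S i (Function.update U i (k a t * U i))) (S' U) 0) ∧
    ∀ f ∈ polyFunctions (ι := ι) r, ∀ f' : (ι → G) → ℝ, Continuous f' →
      (∀ U, HasDerivAt (fun t => f (Function.update U i (k a t * U i))) (f' U) 0) →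
      ∫ U, f' U ∂μ = β * ∫ U, f U * S' U ∂μ

omit [IsTopologicalGroup G] [CompactSpace G] [BorelSpace G] [SecondCountableTopology G] [Countable ι] in
/-- A Schwinger–Dyson state is a polynomial Schwinger–Dyson state. -/
theorem IsSchwingerDysonState.isPolySchwingerDysonState {k : K → ℝ → G} {S : ι → (ι → G) → ℝ}
    {β : ℝ} {μ : Measure (ι → G)} (hμ : IsSchwingerDysonState k S β μ) :
    IsPolySchwingerDysonState r k S β μ := fun i a => by
  obtain ⟨S', hS'c, hS', h⟩ := hμ i a
  exact ⟨S', hS'c, hS', fun f hf f' hf'c hd => h f f' (continuous_of_mem_polyFunctions r hf) hf'c hd⟩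

variable {k : ℝ → G} {X : Matrix (Fin r.N) (Fin r.N) ℂ} {i : ι} {S S' : (ι → G) → ℝ} {β : ℝ}
  {μ : Measure (ι → G)} [IsFiniteMeasure μ]

omit [IsTopologicalGroup G] in
/-- **Step 1 (exponential series).** If the Schwinger–Dyson identity holds for polynomial `f` along
the exponential shift of the link `i`, and the action `S` is polynomial, then
`∫ h' e^{β S} dμ = 0` for every polynomial `h` with flow derivative `h'`: the identity passes to the
limit `f_m = h · Σ_{n<m} (βS)ⁿ/n! → h e^{βS}` by dominated convergence. [folklore] -/
theorem integral_deriv_mul_exp_eq_zero (hk : ∀ s t, k (s + t) = k s * k t)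
    (hS : S ∈ polyFunctions (ι := ι) r) (hS'c : Continuous S')
    (hS' : ∀ U, HasDerivAt (fun t => S (Function.update U i (k t * U i))) (S' U) 0)
    (hsd : ∀ f ∈ polyFunctions (ι := ι) r, ∀ f' : (ι → G) → ℝ, Continuous f' →
      (∀ U, HasDerivAt (fun t => f (Function.update U i (k t * U i))) (f' U) 0) →
      ∫ U, f' U ∂μ = β * ∫ U, f U * S' U ∂μ)
    {h h' : (ι → G) → ℝ} (hh : h ∈ polyFunctions (ι := ι) r) (hh'c : Continuous h')
    (hd : ∀ U, HasDerivAt (fun t => h (Function.update U i (k t * U i))) (h' U) 0) :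
    ∫ U, h' U * Real.exp (β * S U) ∂μ = 0 := by
  have hSc : Continuous S := continuous_of_mem_polyFunctions r hS
  have hhc : Continuous h := continuous_of_mem_polyFunctions r hh
  have h0 : k 0 = 1 := by
    have h := hk 0 0
    rw [add_zero] at h
    exact mul_eq_left.1 h.symm
  have hU0 : ∀ U : ι → G, Function.update U i (k 0 * U i) = U := fun U => by
    rw [h0, one_mul, Function.update_eq_self]
  -- the partial sums `E m`, their derivatives `D m`, the approximants `f m`, `f' m`
  set E : ℕ → ℝ → ℝ := fun m x => ∑ n ∈ Finset.range m, x ^ n / n ! with hE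
  set D : ℕ → ℝ → ℝ := fun m x => ∑ n ∈ Finset.range m, (n : ℝ) * x ^ (n - 1) / n ! with hD
  have hEc : ∀ m, Continuous (E m) := fun m => by
    simp only [hE]; fun_prop
  have hDc : ∀ m, Continuous (D m) := fun m => by
    simp only [hD]; fun_prop
  have hfm : ∀ m, (fun U => h U * E m (β * S U)) ∈ polyFunctions (ι := ι) r := fun m => by
    have : (fun U => h U * E m (β * S U)) =
        h * ∑ n ∈ Finset.range m, ((n ! : ℝ)⁻¹ * β ^ n) • S ^ n := by
      funext U
      simp only [hE, Pi.mul_apply, Finset.sum_apply, Pi.smul_apply, Pi.pow_apply, smul_eq_mul]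
      congr 1
      refine Finset.sum_congr rfl fun n _ => ?_
      rw [mul_pow]
      ring
    rw [this]
    exact Subalgebra.mul_mem _ hh (Subalgebra.sum_mem _ fun n _ =>
      Subalgebra.smul_mem _ (Subalgebra.pow_mem _ hS n) _)
  have hdm : ∀ m U, HasDerivAt (fun t => h (Function.update U i (k t * U i)) *
      E m (β * S (Function.update U i (k t * U i))))
      (h' U * E m (β * S U) + h U * (D m (β * S U) * (β * S' U))) 0 := fun m U => by
    have h1 : HasDerivAt (fun t => E m (β * S (Function.update U i (k t * U i))))
        (D m (β * S (Function.update U i (k 0 * U i))) * (β * S' U)) 0 :=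
      (hasDerivAt_expPartialSum m _).comp 0 ((hS' U).const_mul β)
    rw [hU0] at h1
    have h2 := (hd U).mul h1
    simp only [hU0] at h2
    exact h2
  have hsdm : ∀ m, ∫ U, h' U * E m (β * S U) + h U * (D m (β * S U) * (β * S' U)) ∂μ =
      β * ∫ U, h U * E m (β * S U) * S' U ∂μ := fun m =>
    hsd _ (hfm m) (fun U => h' U * E m (β * S U) + h U * (D m (β * S U) * (β * S' U)))
      ((hh'c.mul ((hEc m).comp (continuous_const.mul hSc))).add
        (hhc.mul (((hDc m).comp (continuous_const.mul hSc)).mul (continuous_const.mul hS'c)))) (hdm m)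
  -- bounds on the compact configuration space
  obtain ⟨Ch, hCh⟩ := isCompact_univ.exists_bound_of_continuousOn hhc.continuousOn
  obtain ⟨Ch', hCh'⟩ := isCompact_univ.exists_bound_of_continuousOn hh'c.continuousOn
  obtain ⟨CS, hCS⟩ := isCompact_univ.exists_bound_of_continuousOn hSc.continuousOn
  obtain ⟨CS', hCS'⟩ := isCompact_univ.exists_bound_of_continuousOn hS'c.continuousOn
  simp only [Set.mem_univ, forall_const, Real.norm_eq_abs] at hCh hCh' hCS hCS'
  have hexp : ∀ U, Real.exp |β * S U| ≤ Real.exp (|β| * CS) := fun U => by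
    rw [abs_mul]
    exact Real.exp_le_exp.2 (mul_le_mul_of_nonneg_left (hCS U) (abs_nonneg β))
  -- dominated convergence on both sides of the identity
  have hlim1 : Tendsto (fun m => ∫ U, h' U * E m (β * S U) + h U * (D m (β * S U) * (β * S' U)) ∂μ)
      atTop (𝓝 (∫ U, h' U * Real.exp (β * S U) + h U * (Real.exp (β * S U) * (β * S' U)) ∂μ)) := by
    refine tendsto_integral_of_dominated_convergence
      (fun _ => |Ch'| * Real.exp (|β| * CS) + |Ch| * (Real.exp (|β| * CS) * (|β| * |CS'|)))
      (fun m => (((hh'c.mul ((hEc m).comp (continuous_const.mul hSc))).add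
        (hhc.mul (((hDc m).comp (continuous_const.mul hSc)).mul
          (continuous_const.mul hS'c)))).aestronglyMeasurable))
      (integrable_const _) (fun m => ae_of_all _ fun U => ?_) (ae_of_all _ fun U => ?_)
    · rw [Real.norm_eq_abs]
      refine (abs_add_le _ _).trans ?_
      rw [abs_mul, abs_mul, abs_mul, abs_mul]
      exact add_le_add (mul_le_mul ((hCh' U).trans (le_abs_self _))
        ((abs_expPartialSum_le m _).trans (hexp U)) (abs_nonneg _) (abs_nonneg _))
        (mul_le_mul ((hCh U).trans (le_abs_self _)) (mul_le_mul
          ((abs_derivPartialSum_le m _).trans (hexp U))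
          (mul_le_mul_of_nonneg_left ((hCS' U).trans (le_abs_self _)) (abs_nonneg β))
          (by positivity) (Real.exp_pos _).le) (by positivity) (abs_nonneg _))
    · exact ((tendsto_const_nhds.mul (tendsto_expPartialSum _)).add
        (tendsto_const_nhds.mul ((tendsto_derivPartialSum _).mul tendsto_const_nhds)))
  have hlim2 : Tendsto (fun m => β * ∫ U, h U * E m (β * S U) * S' U ∂μ) atTop
      (𝓝 (β * ∫ U, h U * Real.exp (β * S U) * S' U ∂μ)) := by
    refine Tendsto.const_mul β (tendsto_integral_of_dominated_convergence
      (fun _ => |Ch| * Real.exp (|β| * CS) * |CS'|)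
      (fun m => ((hhc.mul ((hEc m).comp (continuous_const.mul hSc))).mul hS'c).aestronglyMeasurable)
      (integrable_const _) (fun m => ae_of_all _ fun U => ?_) (ae_of_all _ fun U => ?_))
    · rw [Real.norm_eq_abs, abs_mul, abs_mul]
      exact mul_le_mul (mul_le_mul ((hCh U).trans (le_abs_self _))
        ((abs_expPartialSum_le m _).trans (hexp U)) (abs_nonneg _) (abs_nonneg _))
        ((hCS' U).trans (le_abs_self _)) (abs_nonneg _) (by positivity)
    · exact (tendsto_const_nhds.mul (tendsto_expPartialSum _)).mul tendsto_const_nhds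
  have heq : ∫ U, h' U * Real.exp (β * S U) + h U * (Real.exp (β * S U) * (β * S' U)) ∂μ =
      β * ∫ U, h U * Real.exp (β * S U) * S' U ∂μ :=
    tendsto_nhds_unique (by simpa only [hsdm] using hlim1) hlim2
  have hwc : Continuous fun U => Real.exp (β * S U) := Real.continuous_exp.comp (continuous_const.mul hSc)
  have hi1 : Integrable (fun U => h' U * Real.exp (β * S U)) μ :=
    IsContinuousFlow.integrable_of_continuous_of_compactSpace μ (hh'c.mul hwc)
  have hi2 : Integrable (fun U => h U * (Real.exp (β * S U) * (β * S' U))) μ :=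
    IsContinuousFlow.integrable_of_continuous_of_compactSpace μ
      (hhc.mul (hwc.mul (continuous_const.mul hS'c)))
  have h2 : ∫ U, h U * (Real.exp (β * S U) * (β * S' U)) ∂μ = β * ∫ U, h U * Real.exp (β * S U) * S' U ∂μ := by
    rw [← integral_const_mul]
    exact integral_congr_ae (ae_of_all _ fun U => by ring)
  rw [integral_add hi1 hi2, h2, add_eq_right] at heq
  exact heq

/-- Differentiation under the integral sign along a flow (the bounded Lipschitz family
`t ↦ g(T_t x) w(x)` on a compact space). [folklore] -/
theorem hasDerivAt_integral_comp_flow_mul {Ω : Type*} [TopologicalSpace Ω] [MeasurableSpace Ω]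
    [OpensMeasurableSpace Ω] [CompactSpace Ω] {T : ℝ → Ω → Ω} (hT : IsContinuousFlow T)
    (ν : Measure Ω) [IsFiniteMeasure ν] {w g g' : Ω → ℝ} (hw : Continuous w) (hg : Continuous g)
    (hg' : Continuous g') (hd : ∀ x, HasDerivAt (fun t => g (T t x)) (g' x) 0) :
    HasDerivAt (fun t => ∫ x, g (T t x) * w x ∂ν) (∫ x, g' x * w x ∂ν) 0 := by
  obtain ⟨Cg', hCg'⟩ := isCompact_univ.exists_bound_of_continuousOn hg'.continuousOn
  obtain ⟨Cw, hCw⟩ := isCompact_univ.exists_bound_of_continuousOn hw.continuousOn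
  simp only [Set.mem_univ, forall_const, Real.norm_eq_abs] at hCg' hCw
  have hdt : ∀ (x : Ω) (s : ℝ), HasDerivAt (fun t => g (T t x)) (g' (T s x)) s := fun x s => by
    have h2 : (fun t => g (T t x)) = fun t => g (T (t - s) (T s x)) := by
      funext t; rw [← hT.flow, sub_add_cancel]
    rw [h2]
    have h3 : HasDerivAt (fun t => g (T t (T s x))) (g' (T s x)) (s - s) := by
      rw [sub_self]; exact hd (T s x)
    exact h3.comp_sub_const s s
  have hlipx : ∀ (x : Ω) (t s : ℝ), |g (T t x) - g (T s x)| ≤ Cg' * |t - s| := fun x t s => by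
    have h1 := Convex.norm_image_sub_le_of_norm_hasDerivWithin_le (f := fun t => g (T t x))
      (f' := fun t => g' (T t x)) (s := Set.univ) (x := s) (y := t)
      (fun u _ => (hdt x u).hasDerivWithinAt) (fun u _ => by rw [Real.norm_eq_abs]; exact hCg' _)
      convex_univ (Set.mem_univ _) (Set.mem_univ _)
    simpa only [Real.norm_eq_abs] using h1
  have hlip : ∀ᵐ x ∂ν, LipschitzOnWith (Real.nnabs ((fun _ : Ω => Cg' * Cw) x))
      (fun t => g (T t x) * w x) Set.univ := by
    refine ae_of_all _ fun x => LipschitzOnWith.of_dist_le_mul fun t _ s _ => ?_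
    rw [Real.dist_eq, Real.dist_eq, Real.coe_nnabs, ← sub_mul, abs_mul]
    calc |g (T t x) - g (T s x)| * |w x| ≤ Cg' * |t - s| * Cw :=
          mul_le_mul (hlipx x t s) (hCw x) (abs_nonneg _)
            (mul_nonneg ((abs_nonneg _).trans (hCg' x)) (abs_nonneg _))
      _ = Cg' * Cw * |t - s| := by ring
      _ ≤ |Cg' * Cw| * |t - s| := by gcongr; exact le_abs_self _
  refine (hasDerivAt_integral_of_dominated_loc_of_lip (μ := ν) (F := fun t x => g (T t x) * w x)
    (x₀ := (0 : ℝ)) (s := Set.univ) (bound := fun _ => Cg' * Cw) (F' := fun x => g' x * w x)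
    Filter.univ_mem (Filter.Eventually.of_forall fun t =>
      ((hg.comp (hT.continuous_right t)).mul hw).aestronglyMeasurable)
    (IsContinuousFlow.integrable_of_continuous_of_compactSpace ν ((hg.comp (hT.continuous_right 0)).mul hw))
    (hg'.mul hw).aestronglyMeasurable hlip (integrable_const _) (ae_of_all _ fun x => ?_)).2
  exact (hd x).mul_const (w x)

end Poly

end Summit.QuantumFields.GaugeBoot

end
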